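import Literature.AlgebraicGeometry.HodgeTheory.SignSymmetricOrbitDataAssembly
import Literature.AlgebraicGeometry.HodgeTheory.SignSymmetricLinkedCentresConnected
import HarnessLib

/-!
# The orbit-data assembly with fixed centres of UNKNOWN sign (W-ELIM brick 3b)

Family `hodge`, layer `Literature/AlgebraicGeometry/HodgeTheory`; sequel of `SignSymmetricOrbitDataAssembly` §3 and of
`SignSymmetricLinkedCentresConnected` (theorems only).  Written by the prover seat `hodge-nonav-19716-p2` (g9, cell `hodge-nonav`)
for crux K1-B `VeryGeneralSignCommutatorsInHg` (`Summits/HodgeConjecture/HodgeConjecture/Theses/SignSymmetricPowers.lean`,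
stmt-HodgeConjecture-19716).

`signPencil_clauses_of_orbitData` takes the two fixed Picard–Lefschetz centres with KNOWN parities `τ r_P = r_P`, `τ r_L = −r_L`
(Wall's sign rule at the Π- and L-nodes).  Here the parities are UNKNOWN — `τ r_P = ±r_P`, `τ r_L = ±r_L`, which is automatic for
transvections in a `τ`-commuting `Γ` (`eq_or_eq_neg_of_oneParamTransvection_comm`) — and the output is the hypothesis list of
`mem_glZariskiClosure_of_signSymmetric_of_eigenCentres` / `commutator_mem_hodgeGroup_of_signSymmetric_of_eigenCentres`
(`SignSymmetricOneSeedHodgeGroup`): `hT`, `hD`, eigen-centres, a seed whenever there are pairs, `span R_± = V_±`, and orthogonal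
connectedness of `R_±` — the latter by `orthogonallyConnected_of_links{,_neg}` (every fixed centre is linked to the pair orbit,
whichever side it lies on).  One extra input replaces the parity bookkeeping: BOTH eigenspaces of `τ` are non-zero (in the
application: the `ι`-eigen-Hodge numbers), used only to show `δ₀ ± τδ₀ ≠ 0`.

* `signPencil_clauses_of_orbitData_unsigned` — the assembly.

References: [Deligne1980] P. Deligne, *La conjecture de Weil : II*, §4.4 (4.4.1)–(4.4.4^α), pp. 227–228.
-/

noncomputable section

namespace Literature.AlgebraicGeometry.HodgeTheory

open Literature.AlgebraicGeometry.Motives Literature.LinearAlgebra.Alternating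

universe u v

variable {K : Type u} [Field K] {V : Type v} [AddCommGroup V] [Module K V] {B : LinearMap.BilinForm K V}

/-- **The orbit-data assembly with fixed centres of unknown sign.**  See the module docstring.
[cite: Deligne1980, §4.4 Thm (4.4.1), (4.4.2^α)–(4.4.4^α) pp. 227–228] -/
theorem signPencil_clauses_of_orbitData_unsigned [Module.Finite K V] (hB : B.IsAlt) (hBn : B.Nondegenerate)
    (h2 : (2 : K) ≠ 0) {τ : V →ₗ[K] V} (hτ : τ ^ 2 = 1) (hτB : ∀ x y, B (τ x) (τ y) = B x y)
    {Γ : Subgroup (V ≃ₗ[K] V)} (hΓτ : ∀ g ∈ Γ, ∀ x, g (τ x) = τ (g x))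
    (hΓB : ∀ g ∈ Γ, ∀ x y, B (g x) (g y) = B x y)
    {rP rL δ₀ : V} {c₁ c₂ c₃ : K} {E : Set (V ≃ₗ[K] V)}
    (hrP : τ rP = rP ∨ τ rP = -rP) (hrL : τ rL = rL ∨ τ rL = -rL) (hδ₀ : B δ₀ (τ δ₀) = 0)
    (hc₁ : c₁ ≠ 0) (hc₂ : c₂ ≠ 0) (hc₃ : c₃ ≠ 0)
    (huP : oneParamTransvectionEquiv B (hB rP) c₁ ∈ Γ) (huL : oneParamTransvectionEquiv B (hB rL) c₂ ∈ Γ)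
    (huδ : oneParamTransvectionEquiv B (hB δ₀) c₃ * oneParamTransvectionEquiv B (hB (τ δ₀)) c₃ ∈ Γ)
    (hΓE : Γ = Subgroup.closure E)
    (hE : ∀ e ∈ E, ∃ g ∈ Γ, e = g * oneParamTransvectionEquiv B (hB rP) c₁ * g⁻¹ ∨
      e = g * oneParamTransvectionEquiv B (hB rL) c₂ * g⁻¹ ∨
      e = g * (oneParamTransvectionEquiv B (hB δ₀) c₃ * oneParamTransvectionEquiv B (hB (τ δ₀)) c₃) * g⁻¹)
    (hinv : ∀ x : V, (∀ g ∈ Γ, g x = x) → x = 0)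
    (hlinkP : ∃ g ∈ Γ, B rP (g δ₀) ≠ 0) (hlinkL : ∃ g ∈ Γ, B rL (g δ₀) ≠ 0)
    (hVpos : ∃ v : V, v ≠ 0 ∧ τ v = v) (hVneg : ∃ v : V, v ≠ 0 ∧ τ v = -v) :
    let T : Set V := {x | ∃ g ∈ Γ, x = g rP ∨ x = -(g rP) ∨ x = g rL ∨ x = -(g rL)}
    let D : Set V := {x | ∃ g ∈ Γ, x = g δ₀ ∨ x = -(g δ₀) ∨ x = g (τ δ₀) ∨ x = -(g (τ δ₀))}
    let RP : Set V := {r ∈ T | τ r = r} ∪ (fun δ => δ + τ δ) '' D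
    let RN : Set V := {r ∈ T | τ r = -r} ∪ (fun δ => δ - τ δ) '' D
    (∀ r ∈ T, ∃ c : K, c ≠ 0 ∧ oneParamTransvectionEquiv B (hB r) c ∈ Γ) ∧
    (∀ δ ∈ D, B δ (τ δ) = 0 ∧ ∃ c : K, c ≠ 0 ∧
      oneParamTransvectionEquiv B (hB δ) c * oneParamTransvectionEquiv B (hB (τ δ)) c ∈ Γ) ∧
    (∀ r ∈ T, τ r = r ∨ τ r = -r) ∧ (D.Nonempty → T.Nonempty) ∧
    Submodule.span K RP = Module.End.eigenspace τ 1 ∧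
    (∀ A' ⊆ RP, A'.Nonempty → A' ≠ RP → ∃ r ∈ A', ∃ ρ ∈ RP, ρ ∉ A' ∧ B r ρ ≠ 0) ∧
    Submodule.span K RN = Module.End.eigenspace τ (-1) ∧
    (∀ A' ⊆ RN, A'.Nonempty → A' ≠ RN → ∃ r ∈ A', ∃ ρ ∈ RN, ρ ∉ A' ∧ B r ρ ≠ 0) := by
  intro T D RP RN
  have hττ : ∀ x, τ (τ x) = x := fun x => by
    rw [← Module.End.mul_apply, ← pow_two, hτ, Module.End.one_apply]
  have hinvapp : ∀ (g : V ≃ₗ[K] V) (x : V), g⁻¹ (g x) = x := fun g x => by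
    rw [← LinearEquiv.mul_apply, inv_mul_cancel, LinearEquiv.coe_one, id_eq]
  have hone : ∀ x : V, (1 : V ≃ₗ[K] V) x = x := fun x => by rw [LinearEquiv.coe_one, id_eq]
  have hnegself : ∀ v : V, v = -v → v = 0 := by
    intro v hv
    have h : (2 : K) • v = 0 := by
      rw [two_smul]
      nth_rw 2 [hv]
      exact add_neg_cancel v
    exact (smul_eq_zero.1 h).resolve_left h2
  -- `V₊ ⊥ V₋`
  have hB0 : ∀ a r : V, τ a = a → τ r = -r → B a r = 0 := by
    intro a r ha hr
    have h : B a r = -B a r := by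
      conv_lhs => rw [← hτB a r, ha, hr, map_neg]
    have h' : (2 : K) * B a r = 0 := by rw [two_mul]; nth_rw 2 [h]; exact add_neg_cancel _
    exact (mul_eq_zero.1 h').resolve_left h2
  -- the basic vectors are non-zero
  have hrP0 : rP ≠ 0 := by
    rintro rfl
    obtain ⟨g, -, h⟩ := hlinkP
    exact h (by rw [map_zero, LinearMap.zero_apply])
  have hrL0 : rL ≠ 0 := by
    rintro rfl
    obtain ⟨g, -, h⟩ := hlinkL
    exact h (by rw [map_zero, LinearMap.zero_apply])
  -- conjugation inside `Γ`
  have hconj : ∀ g ∈ Γ, ∀ (r : V) (c : K),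
      g * oneParamTransvectionEquiv B (hB r) c * g⁻¹ = oneParamTransvectionEquiv B (hB (g r)) c :=
    fun g hg r c => conj_oneParamTransvectionEquiv hB (hΓB g hg) r c
  have hconj2 : ∀ g ∈ Γ, ∀ c : K,
      g * (oneParamTransvectionEquiv B (hB δ₀) c * oneParamTransvectionEquiv B (hB (τ δ₀)) c) * g⁻¹ =
        oneParamTransvectionEquiv B (hB (g δ₀)) c * oneParamTransvectionEquiv B (hB (τ (g δ₀))) c := by
    intro g hg c
    rw [conj_pair_oneParamTransvectionEquiv hB (hΓB g hg), hΓτ g hg]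
  have hUneg : ∀ (r : V) (c : K),
      oneParamTransvectionEquiv B (hB (-r)) c = oneParamTransvectionEquiv B (hB r) c :=
    oneParamTransvectionEquiv_neg hB
  have hmemP : ∀ g ∈ Γ, oneParamTransvectionEquiv B (hB (g rP)) c₁ ∈ Γ := fun g hg => by
    rw [← hconj g hg rP c₁]; exact Γ.mul_mem (Γ.mul_mem hg huP) (Γ.inv_mem hg)
  have hmemL : ∀ g ∈ Γ, oneParamTransvectionEquiv B (hB (g rL)) c₂ ∈ Γ := fun g hg => by
    rw [← hconj g hg rL c₂]; exact Γ.mul_mem (Γ.mul_mem hg huL) (Γ.inv_mem hg)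
  have hmemδ : ∀ g ∈ Γ, oneParamTransvectionEquiv B (hB (g δ₀)) c₃ *
      oneParamTransvectionEquiv B (hB (τ (g δ₀))) c₃ ∈ Γ := fun g hg => by
    rw [← hconj2 g hg c₃]; exact Γ.mul_mem (Γ.mul_mem hg huδ) (Γ.inv_mem hg)
  have horthδ : ∀ g ∈ Γ, B (g δ₀) (τ (g δ₀)) = 0 := fun g hg => by
    rw [← hΓτ g hg, hΓB g hg, hδ₀]
  -- C6
  have C6 : ∀ r ∈ T, ∃ c : K, c ≠ 0 ∧ oneParamTransvectionEquiv B (hB r) c ∈ Γ := by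
    rintro _ ⟨g, hg, rfl | rfl | rfl | rfl⟩
    · exact ⟨c₁, hc₁, hmemP g hg⟩
    · exact ⟨c₁, hc₁, by rw [hUneg]; exact hmemP g hg⟩
    · exact ⟨c₂, hc₂, hmemL g hg⟩
    · exact ⟨c₂, hc₂, by rw [hUneg]; exact hmemL g hg⟩
  -- C7
  have C7 : ∀ δ ∈ D, B δ (τ δ) = 0 ∧ ∃ c : K, c ≠ 0 ∧
      oneParamTransvectionEquiv B (hB δ) c * oneParamTransvectionEquiv B (hB (τ δ)) c ∈ Γ := by
    rintro _ ⟨g, hg, rfl | rfl | rfl | rfl⟩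
    · exact ⟨horthδ g hg, c₃, hc₃, hmemδ g hg⟩
    · refine ⟨by rw [map_neg τ, map_neg B, LinearMap.neg_apply, map_neg, neg_neg, horthδ g hg], c₃, hc₃, ?_⟩
      rw [map_neg τ (g δ₀), hUneg, hUneg]
      exact hmemδ g hg
    · have hτg : τ (g (τ δ₀)) = g δ₀ := by rw [← hΓτ g hg, hττ]
      have h0 : B (g (τ δ₀)) (g δ₀) = 0 := by rw [hΓτ g hg, ← hB.neg_eq, horthδ g hg, neg_zero]
      refine ⟨by rw [hτg, h0], c₃, hc₃, ?_⟩
      rw [hτg, (commute_oneParamTransvectionEquiv hB h0 c₃).eq, hΓτ g hg]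
      exact hmemδ g hg
    · have hτg : τ (g (τ δ₀)) = g δ₀ := by rw [← hΓτ g hg, hττ]
      have h0 : B (g (τ δ₀)) (g δ₀) = 0 := by rw [hΓτ g hg, ← hB.neg_eq, horthδ g hg, neg_zero]
      refine ⟨by rw [map_neg τ, hτg, map_neg B, LinearMap.neg_apply, map_neg, neg_neg, h0], c₃, hc₃, ?_⟩
      rw [map_neg τ, hτg, hUneg, hUneg, (commute_oneParamTransvectionEquiv hB h0 c₃).eq, hΓτ g hg]
      exact hmemδ g hg
  -- structure of `T` (signs propagate from `rP`, `rL` whatever they are)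
  have hsignmap : ∀ g ∈ Γ, ∀ r : V, (τ r = r ∨ τ r = -r) → (τ (g r) = g r ∨ τ (g r) = -(g r)) := by
    intro g hg r h
    rcases h with h | h
    · exact Or.inl (by rw [← hΓτ g hg, h])
    · exact Or.inr (by rw [← hΓτ g hg, h, map_neg])
  have hsignneg : ∀ r : V, (τ r = r ∨ τ r = -r) → (τ (-r) = -r ∨ τ (-r) = -(-r)) := by
    intro r h
    rcases h with h | h
    · exact Or.inl (by rw [map_neg, h])
    · exact Or.inr (by rw [map_neg, h])
  have hTτ : ∀ r ∈ T, τ r = r ∨ τ r = -r := by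
    rintro _ ⟨g, hg, rfl | rfl | rfl | rfl⟩
    · exact hsignmap g hg rP hrP
    · exact hsignneg _ (hsignmap g hg rP hrP)
    · exact hsignmap g hg rL hrL
    · exact hsignneg _ (hsignmap g hg rL hrL)
  have hTst : ∀ g ∈ Γ, ∀ r ∈ T, g r ∈ T := by
    rintro g hg _ ⟨g', hg', rfl | rfl | rfl | rfl⟩
    · exact ⟨g * g', Γ.mul_mem hg hg', Or.inl (by rw [LinearEquiv.mul_apply])⟩
    · exact ⟨g * g', Γ.mul_mem hg hg', Or.inr (Or.inl (by rw [map_neg, LinearEquiv.mul_apply]))⟩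
    · exact ⟨g * g', Γ.mul_mem hg hg', Or.inr (Or.inr (Or.inl (by rw [LinearEquiv.mul_apply])))⟩
    · exact ⟨g * g', Γ.mul_mem hg hg', Or.inr (Or.inr (Or.inr (by rw [map_neg, LinearEquiv.mul_apply])))⟩
  have hT0 : ∀ r ∈ T, r ≠ 0 := by
    rintro _ ⟨g, hg, rfl | rfl | rfl | rfl⟩
    · exact fun h => hrP0 ((LinearEquiv.map_eq_zero_iff g).1 h)
    · exact fun h => hrP0 ((LinearEquiv.map_eq_zero_iff g).1 (neg_eq_zero.1 h))
    · exact fun h => hrL0 ((LinearEquiv.map_eq_zero_iff g).1 h)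
    · exact fun h => hrL0 ((LinearEquiv.map_eq_zero_iff g).1 (neg_eq_zero.1 h))
  -- every fixed centre is linked to the pair orbit
  have hlinkT : ∀ r ∈ T, ∃ δ ∈ D, B r δ ≠ 0 := by
    obtain ⟨gP, hgP, hP⟩ := hlinkP
    obtain ⟨gL, hgL, hL⟩ := hlinkL
    have key : ∀ g ∈ Γ, ∀ (r : V) (g' : V ≃ₗ[K] V), g' ∈ Γ → B r (g' δ₀) ≠ 0 →
        (∃ δ ∈ D, B (g r) δ ≠ 0) ∧ (∃ δ ∈ D, B (-(g r)) δ ≠ 0) := by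
      intro g hg r g' hg' h
      have hmem : (g * g') δ₀ ∈ D := ⟨g * g', Γ.mul_mem hg hg', Or.inl rfl⟩
      have hval : B (g r) ((g * g') δ₀) = B r (g' δ₀) := by rw [LinearEquiv.mul_apply, hΓB g hg]
      refine ⟨⟨_, hmem, by rw [hval]; exact h⟩, ⟨_, hmem, ?_⟩⟩
      rw [map_neg, LinearMap.neg_apply, hval, neg_ne_zero]
      exact h
    rintro _ ⟨g, hg, rfl | rfl | rfl | rfl⟩
    · exact (key g hg rP gP hgP hP).1
    · exact (key g hg rP gP hgP hP).2
    · exact (key g hg rL gL hgL hL).1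
    · exact (key g hg rL gL hgL hL).2
  -- structure of `D`
  have hDst : ∀ g ∈ Γ, ∀ δ ∈ D, g δ ∈ D := by
    rintro g hg _ ⟨g', hg', rfl | rfl | rfl | rfl⟩
    · exact ⟨g * g', Γ.mul_mem hg hg', Or.inl (by rw [LinearEquiv.mul_apply])⟩
    · exact ⟨g * g', Γ.mul_mem hg hg', Or.inr (Or.inl (by rw [map_neg, LinearEquiv.mul_apply]))⟩
    · exact ⟨g * g', Γ.mul_mem hg hg', Or.inr (Or.inr (Or.inl (by rw [LinearEquiv.mul_apply])))⟩
    · exact ⟨g * g', Γ.mul_mem hg hg', Or.inr (Or.inr (Or.inr (by rw [map_neg, LinearEquiv.mul_apply])))⟩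
  have hDτ : ∀ δ ∈ D, τ δ ∈ D := by
    rintro _ ⟨g, hg, rfl | rfl | rfl | rfl⟩
    · exact ⟨g, hg, Or.inr (Or.inr (Or.inl (hΓτ g hg δ₀).symm))⟩
    · exact ⟨g, hg, Or.inr (Or.inr (Or.inr (by rw [map_neg, hΓτ g hg])))⟩
    · exact ⟨g, hg, Or.inl (by rw [← hΓτ g hg, hττ])⟩
    · exact ⟨g, hg, Or.inr (Or.inl (by rw [map_neg, ← hΓτ g hg, hττ]))⟩
  -- transitivity of `Γ` on `D` up to sign and `τ`
  have Psymm : ∀ w x : V, (x = w ∨ x = -w ∨ x = τ w ∨ x = -(τ w)) →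
      (w = x ∨ w = -x ∨ w = τ x ∨ w = -(τ x)) := by
    rintro w _ (rfl | rfl | rfl | rfl)
    · exact Or.inl rfl
    · exact Or.inr (Or.inl (neg_neg w).symm)
    · exact Or.inr (Or.inr (Or.inl (hττ w).symm))
    · exact Or.inr (Or.inr (Or.inr (by rw [map_neg, hττ, neg_neg])))
  have Ptrans : ∀ w x y : V, (x = w ∨ x = -w ∨ x = τ w ∨ x = -(τ w)) →
      (y = x ∨ y = -x ∨ y = τ x ∨ y = -(τ x)) → (y = w ∨ y = -w ∨ y = τ w ∨ y = -(τ w)) := by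
    rintro w _ _ (rfl | rfl | rfl | rfl) (rfl | rfl | rfl | rfl) <;>
      simp only [neg_neg, map_neg, hττ, true_or, or_true]
  have Pmap : ∀ g ∈ Γ, ∀ w x : V, (x = w ∨ x = -w ∨ x = τ w ∨ x = -(τ w)) →
      (g x = g w ∨ g x = -(g w) ∨ g x = τ (g w) ∨ g x = -(τ (g w))) := by
    rintro g hg w _ (rfl | rfl | rfl | rfl)
    · exact Or.inl rfl
    · exact Or.inr (Or.inl (map_neg g w))
    · exact Or.inr (Or.inr (Or.inl (hΓτ g hg w)))
    · exact Or.inr (Or.inr (Or.inr (by rw [map_neg, hΓτ g hg])))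
  have hDP : ∀ δ ∈ D, ∃ g ∈ Γ, δ = g δ₀ ∨ δ = -(g δ₀) ∨ δ = τ (g δ₀) ∨ δ = -(τ (g δ₀)) := by
    rintro δ ⟨g, hg, h⟩
    refine ⟨g, hg, ?_⟩
    rwa [hΓτ g hg] at h
  have htransD : ∀ δ ∈ D, ∀ δ' ∈ D, ∃ g ∈ Γ,
      g δ = δ' ∨ g δ = -δ' ∨ g δ = τ δ' ∨ g δ = -(τ δ') := by
    intro δ hδ δ' hδ'
    obtain ⟨g₁, hg₁, h₁⟩ := hDP δ hδ
    obtain ⟨g₂, hg₂, h₂⟩ := hDP δ' hδ'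
    refine ⟨g₂ * g₁⁻¹, Γ.mul_mem hg₂ (Γ.inv_mem hg₁), ?_⟩
    have h₃ := Pmap g₁⁻¹ (Γ.inv_mem hg₁) _ _ h₁
    rw [hinvapp] at h₃
    have h₄ := Pmap g₂ hg₂ _ _ h₃
    rw [← LinearEquiv.mul_apply] at h₄
    exact Ptrans _ _ _ (Psymm _ _ h₂) h₄
  -- generators in the shape of `SignSymmetricTransvectionMonodromy` §4
  have hE4 : ∀ e ∈ E, (∃ r ∈ T, ∃ c : K, (e : V →ₗ[K] V) = oneParamTransvection B r c) ∨
      (∃ δ ∈ D, ∃ c : K,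
        (e : V →ₗ[K] V) = oneParamTransvection B δ c * oneParamTransvection B (τ δ) c) := by
    intro e he
    obtain ⟨g, hg, h | h | h⟩ := hE e he
    · exact Or.inl ⟨g rP, ⟨g, hg, Or.inl rfl⟩, c₁, by rw [h, hconj g hg, coe_oneParamTransvectionEquiv]⟩
    · exact Or.inl ⟨g rL, ⟨g, hg, Or.inr (Or.inr (Or.inl rfl))⟩, c₂, by
        rw [h, hconj g hg, coe_oneParamTransvectionEquiv]⟩
    · exact Or.inr ⟨g δ₀, ⟨g, hg, Or.inl rfl⟩, c₃, by
        rw [h, hconj2 g hg, LinearEquiv.coe_toLinearMap_mul, coe_oneParamTransvectionEquiv,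
          coe_oneParamTransvectionEquiv]⟩
  -- spanning
  have hTD : Submodule.span K (T ∪ D) = ⊤ := by
    refine span_eq_top_of_generators hB hBn hΓE (S := T ∪ D) (fun e he => ?_) hinv
    rcases hE4 e he with ⟨r, hr, c, hec⟩ | ⟨δ, hδ, c, hec⟩
    · exact Or.inl ⟨r, Or.inl hr, c, hec⟩
    · exact Or.inr ⟨δ, Or.inr hδ, τ δ, Or.inr (hDτ δ hδ), c, hec⟩
  have C8 : Submodule.span K RP = Module.End.eigenspace τ 1 :=
    span_signSymmetric_eq_eigenspace_one h2 hτ hTτ hTD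
  have C11 : Submodule.span K RN = Module.End.eigenspace τ (-1) :=
    span_signSymmetric_eq_eigenspace_neg_one h2 hτ hTτ hTD
  -- `δ₀ ± τδ₀ ≠ 0`: otherwise all centres lie in ONE eigenspace of `τ`, which is then all of `V`
  have hδ₀D : δ₀ ∈ D := ⟨1, Γ.one_mem, Or.inl (hone δ₀).symm⟩
  have hDsign : ∀ s : K, (s = 1 ∨ s = -1) → τ δ₀ = s • δ₀ → ∀ δ ∈ D, τ δ = s • δ := by
    intro s hs hδs
    have hss : s * s = 1 := by rcases hs with rfl | rfl <;> norm_num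
    have hτs : τ (τ δ₀) = s • τ δ₀ := by rw [hδs, map_smul, hδs, smul_smul, hss, one_smul]
    rintro _ ⟨g, hg, rfl | rfl | rfl | rfl⟩
    · rw [← hΓτ g hg, hδs, map_smul]
    · rw [map_neg, ← hΓτ g hg, hδs, map_smul, smul_neg]
    · rw [← hΓτ g hg, hτs, map_smul]
    · rw [map_neg, ← hΓτ g hg, hτs, map_smul, smul_neg]
  have hspanLe : ∀ s : K, (∀ x ∈ T ∪ D, τ x = s • x) → ∀ v : V, τ v = s • v := by
    intro s hall v
    have hv : v ∈ Submodule.span K (T ∪ D) := by rw [hTD]; exact Submodule.mem_top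
    refine Submodule.span_induction (p := fun w _ => τ w = s • w) hall (by rw [map_zero, smul_zero])
      (fun x y _ _ hx hy => by rw [map_add, hx, hy, smul_add]) (fun a x _ hx => by rw [map_smul, hx, smul_comm]) hv
  have hsum0 : δ₀ + τ δ₀ ≠ 0 := by
    intro h0
    have hδs : τ δ₀ = (-1 : K) • δ₀ := by rw [neg_one_smul]; exact eq_neg_of_add_eq_zero_right h0
    have hD' := hDsign (-1) (Or.inr rfl) hδs
    have hT' : ∀ r ∈ T, τ r = (-1 : K) • r := by
      intro r hr
      obtain ⟨δ, hδ, hne⟩ := hlinkT r hr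
      rcases hTτ r hr with h | h
      · exact absurd (hB0 r δ h (by rw [hD' δ hδ, neg_one_smul])) hne
      · rw [h, neg_one_smul]
    obtain ⟨v, hv0, hv⟩ := hVpos
    have hall : ∀ x ∈ T ∪ D, τ x = (-1 : K) • x := by
      rintro x (hx | hx)
      · exact hT' x hx
      · exact hD' x hx
    have := hspanLe (-1) hall v
    rw [hv, neg_one_smul] at this
    exact hv0 (hnegself v this)
  have hdiff0 : δ₀ - τ δ₀ ≠ 0 := by
    intro h0
    have hδs : τ δ₀ = (1 : K) • δ₀ := by rw [one_smul]; exact (sub_eq_zero.1 h0).symm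
    have hD' := hDsign 1 (Or.inl rfl) hδs
    have hT' : ∀ r ∈ T, τ r = (1 : K) • r := by
      intro r hr
      obtain ⟨δ, hδ, hne⟩ := hlinkT r hr
      rcases hTτ r hr with h | h
      · rw [h, one_smul]
      · exfalso
        apply hne
        rw [← hB.neg_eq, hB0 δ r (by rw [hD' δ hδ, one_smul]) h, neg_zero]
    obtain ⟨v, hv0, hv⟩ := hVneg
    have hall : ∀ x ∈ T ∪ D, τ x = (1 : K) • x := by
      rintro x (hx | hx)
      · exact hT' x hx
      · exact hD' x hx
    have := hspanLe 1 hall v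
    rw [hv, one_smul] at this
    exact hv0 (hnegself v this.symm)
  have hdiff0' : τ δ₀ - δ₀ ≠ 0 := by rwa [← neg_sub, neg_ne_zero]
  have hD0P : ∀ δ ∈ D, δ + τ δ ≠ 0 := by
    rintro _ ⟨g, hg, rfl | rfl | rfl | rfl⟩
    · rw [← hΓτ g hg, ← map_add]
      exact fun h => hsum0 ((LinearEquiv.map_eq_zero_iff g).1 h)
    · rw [map_neg, ← hΓτ g hg, ← neg_add, ← map_add, neg_ne_zero]
      exact fun h => hsum0 ((LinearEquiv.map_eq_zero_iff g).1 h)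
    · rw [← hΓτ g hg, hττ, ← map_add, add_comm]
      exact fun h => hsum0 ((LinearEquiv.map_eq_zero_iff g).1 h)
    · rw [map_neg, ← hΓτ g hg, hττ, ← neg_add, ← map_add, neg_ne_zero, add_comm]
      exact fun h => hsum0 ((LinearEquiv.map_eq_zero_iff g).1 h)
  have hD0N : ∀ δ ∈ D, δ - τ δ ≠ 0 := by
    rintro _ ⟨g, hg, rfl | rfl | rfl | rfl⟩
    · rw [← hΓτ g hg, ← map_sub]
      exact fun h => hdiff0 ((LinearEquiv.map_eq_zero_iff g).1 h)
    · rw [map_neg, ← hΓτ g hg, neg_sub_neg, ← map_sub]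
      exact fun h => hdiff0' ((LinearEquiv.map_eq_zero_iff g).1 h)
    · rw [← hΓτ g hg, hττ, ← map_sub]
      exact fun h => hdiff0' ((LinearEquiv.map_eq_zero_iff g).1 h)
    · rw [map_neg, ← hΓτ g hg, hττ, neg_sub_neg, ← map_sub]
      exact fun h => hdiff0 ((LinearEquiv.map_eq_zero_iff g).1 h)
  have hDσ0 : ∀ δ ∈ D, B δ (τ δ) = 0 := fun δ hδ => (C7 δ hδ).1
  -- connectivity from links only
  have C9 : ∀ A' ⊆ RP, A'.Nonempty → A' ≠ RP → ∃ r ∈ A', ∃ ρ ∈ RP, ρ ∉ A' ∧ B r ρ ≠ 0 :=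
    orthogonallyConnected_of_links hB hBn h2 hτ hτB hΓE hΓτ hE4 hTτ hTst (fun r hr _ => hT0 r hr) hDσ0 hDst hD0P
      ⟨δ₀, hδ₀D⟩ htransD (fun r hr _ => hlinkT r hr) C8
  have C12 : ∀ A' ⊆ RN, A'.Nonempty → A' ≠ RN → ∃ r ∈ A', ∃ ρ ∈ RN, ρ ∉ A' ∧ B r ρ ≠ 0 :=
    orthogonallyConnected_of_links_neg hB hBn h2 hτ hτB hΓE hΓτ hE4 hTτ hTst (fun r hr _ => hT0 r hr) hDσ0 hDst hD0N
      ⟨δ₀, hδ₀D⟩ htransD (fun r hr _ => hlinkT r hr) C11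
  have hrPT : rP ∈ T := ⟨1, Γ.one_mem, Or.inl (hone rP).symm⟩
  exact ⟨C6, C7, hTτ, fun _ => ⟨rP, hrPT⟩, C8, C9, C11, C12⟩

end Literature.AlgebraicGeometry.HodgeTheory

end
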